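import Literature.Combinatorics.Optimization.RationalPsdRank
import HarnessLib

/-!
# Biplanar octahedra have psd rank four, the others five (Gouveia–Robinson–Thomas 2013, Thm. 4.8) — PROVED in GRT's normal form

Source: J. Gouveia, R. Z. Robinson, R. R. Thomas, *Polytopes of minimum positive semidefinite rank*,
Discrete Comput. Geom. 50 (2013) 679–699 = arXiv:1205.5306 [GouveiaRobinsonThomas2013], §4 (held text
`paper:arxiv-1205.5306`, chunks p11–p12). Companion of the tree's `PsdMinimalPolytopes.lean` (GRT §§2–4
for polygons; "NOT here: the `ℝ³` classification (Thm. 4.8 biplanar octahedra, …)") and of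
`OctahedronPsdRankFive.lean` (Example 4.5).

The printed text (p11–p12, verbatim). "Let `O ⊂ ℝ³` be a (combinatorial) octahedron. We say that `O` is
planar with respect to a plane `E` if `O ∩ E` contains four vertices of `O`. … We say `O` is biplanar if
it is planar with respect to at least two distinct planes. **Theorem 4.8.** An octahedron `O ⊂ ℝ³` has
psd rank four if and only if `O` is biplanar. *Proof.* First, assume `O` is biplanar. Then, by applying
an affine transformation, we can assume that `O` is planar with respect to the `xy` plane and has
vertices `(0,0,0)`, `(1,0,0)`, `(0,1,0)`, `(a,b,0)`, `(z₁,z₂,z₃)`, and `(w₁,w₂,w₃)` where `z₃ > 0`,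
`w₃ < 0`, and `a+b > 1`. For ease of notation, let `α = z₃ − w₃`, `β = w₁z₃ − z₁w₃`, and
`γ = w₂z₃ − z₂w₃`. Then `(0,0,0)`, `(a,b,0)`, `(z₁,z₂,z₃)`, `(w₁,w₂,w₃)` are coplanar if and only if
`bβ = aγ` and `(1,0,0)`, `(0,1,0)`, `(z₁,z₂,z₃)`, `(w₁,w₂,w₃)` are coplanar if and only if `α = β + γ`.
The combinatorics of `O` dictates that these are the only possible further planarities, and since `O`
is biplanar, at least one of these conditions must be satisfied. Now `O` has slack matrix `S_O`:
`[[0,0,b,a,0,0,b,a],[1,0,0,a+b−1,1,0,0,a+b−1],[0,1,a+b−1,0,0,1,a+b−1,0],[a,b,0,0,a,b,0,0],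
[0,0,0,0,−β/w₃,−γ/w₃,(b(β−α)+(1−a)γ)/w₃,(a(γ−α)+(1−b)β)/w₃],
[β/z₃,γ/z₃,(b(α−β)+(a−1)γ)/z₃,(a(α−γ)+(b−1)β)/z₃,0,0,0,0]]`. In the case `bβ = aγ` or the case
`α = β + γ`, row reduction shows that `⁺√S_O` has rank four. Hence, `O` has psd rank four." (The
converse is proved in print by a Macaulay2 colon-ideal computation on a `5 × 5` submatrix in a second
normal form.)

What is PROVED here, for the printed matrix `S_O = planarOctahedronSlack a b z w` under the printed
side conditions `z₃ > 0`, `w₃ < 0`, `a + b > 1` together with `a, b > 0` and positivity of the four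
slacks `β, γ, b(α−β)+(a−1)γ, a(α−γ)+(b−1)β` (the hypotheses `PlanarOctahedronHyp`: exactly the
statement that the six points are the vertices of an octahedron with this slack matrix — every vertex
strictly inside the facets not containing it):

| claim | Lean | status |
|---|---|---|
| `S_O` is the slack matrix of the six points against eight explicit inequalities, tight exactly on the octahedron's vertex–facet incidences | `planarOctahedronSlack_eq_slack`, `PlanarOctahedronHyp.eq_zero_iff` | PROVED |
| "coplanar iff `bβ = aγ`", "coplanar iff `α = β + γ`" as `3 × 3` determinants | `det_planarity_one`, `det_planarity_two` | PROVED |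
| `rank S_O = 4`, `rank_psd S_O ≥ 4` | `PlanarOctahedronHyp.rank_eq_four`, `PlanarOctahedronHyp.four_le_of_hasPsdFactorization` | PROVED |
| `rank_psd S_O ≤ 5` always (`⁺√S_O` has rank `≤ 5`: its row `4` is `−√(a+b−1)·r₁ + √a·r₂ + √b·r₃`) | `planarOctahedronSqrt_row_three`, `PlanarOctahedronHyp.hasPsdFactorization_five` | PROVED |
| **Thm 4.8 ⇐** "In the case `bβ = aγ` or the case `α = β + γ`, row reduction shows that `⁺√S_O` has rank four. Hence, `O` has psd rank four" | `PlanarOctahedronHyp.sqrt_key`, `.sqrt_row_four`, `.hasHadamardSqrtOfRankLE_four`, **`.hasPsdFactorization_four`** | PROVED |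
| **Thm 4.8 ⇒** for octahedra planar with respect to the `xy` plane: if NEITHER `bβ = aγ` NOR `α = β + γ`, then every Hadamard square root of `S_O` has rank `≥ 5` and `rank_psd S_O = 5` | `PlanarOctahedronHyp.linearIndependent_rows_of_sq_eq`, `.five_le_rank_of_sq_eq`, `.not_hasHadamardSqrtOfRankLE_four`, `.factors_rank_le_one`, **`.not_hasPsdFactorization_four`** | PROVED |
| **Theorem 4.8** for `S_O`: `rank_psd S_O = 4` iff (`bβ = aγ` or `α = β + γ`), and `= 5` otherwise | **`GouveiaRobinsonThomas2013_thm48`** | PROVED |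

The "row reduction" made explicit (no computer algebra). Rows `1–4` of `⁺√S_O` are `[X X]` with `X`
the positive square root of the slack matrix of the planar quadrilateral `(0,0,0),(1,0,0),(0,1,0),
(a,b,0)`, which is singular: `−√(a+b−1)·r₁ + √a·r₂ + √b·r₃ − r₄ = 0` (GRT Thm. 4.3's signed square
root for four coplanar vertices, here with all signs `+`). Rows `5, 6` are `[0 √y]`, `[√x 0]` with
`y = μx`, `μ = −z₃/w₃ > 0`. Hence `rank ⁺√S_O ≤ 5` always, and `= 4` exactly when `√x` lies in the row
space of `X`, which unwinds to the single identity
`√(a+b−1)·(√(aγ) − √(bβ)) = √(a·E₃) − √(b·E₄)`, `E₃ = b(α−β)+(a−1)γ`, `E₄ = a(α−γ)+(b−1)β`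
(`PlanarOctahedronHyp.sqrt_key`): under `bβ = aγ` both sides vanish (`aE₃ − bE₄ = (a+b−1)(aγ − bβ)`),
under `α = β+γ` one has `E₃ = (a+b−1)γ`, `E₄ = (a+b−1)β`.

The converse made explicit (replacing the Macaulay2 step, for THIS normal form). Let `N ∘ N = S_O` with
arbitrary signs and suppose `p r₁ + q r₂ + r r₃ + e r₅ + f r₆ = 0` on the rows `1,2,3,5,6` of `N`.
Columns `1–4` give `q = −f N₂₁N₆₁`, `r = −f N₃₂N₆₂`, `p N₁₃ = f(N₆₂N₃₂N₃₃ − N₆₃)`,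
`p N₁₄ = f(N₆₁N₂₁N₂₄ − N₆₄)`; if `f ≠ 0` the four signed products `X = N₁₄N₆₂N₃₂N₃₃`, `U = N₁₄N₆₃`,
`Y = N₁₃N₆₁N₂₁N₂₄`, `V = N₁₃N₆₄` satisfy `X + V = Y + U` and — squares being entries of `S_O` —
`X² + V² = Y² + U²` (this is `aE₃ − bE₄ = (a+b−1)(aγ − bβ)` again); so `XV = YU` and
`(X − Y)(X − U) = 0`: `X² = Y²` is `aγ = bβ`, `X² = U²` is `(a+b−1)γ = E₃`, i.e. `α = β + γ`. Hence for a
non-biplanar `O` every Hadamard square root has independent rows `1,2,3,5,6`, rank `≥ 5`; rank-one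
factors (GRT Prop. 2.6/3.2 via the triangular `3`-patterns of the octahedral support,
`PlanarOctahedronHyp.factors_rank_le_one`) then exclude a psd factorization of size `4`.

NOT typed: the reduction of an arbitrary biplanar octahedron to this normal form ("by applying an
affine transformation"), and GRT's second normal form `v₁=(0,0,1), v₂=0, v₃=e₁, v₅=e₂` for octahedra
planar to NO plane (their `5 × 5` matrix `M` and the colon ideal `I : J`) — so the typed "only if" covers
the octahedra with at least one planarity (the `xy` plane here), which is where biplanarity is decided;
Lemma 4.9 – Thm. 4.12 (the `ℝ³` classification, perfect graphs) are not typed.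
-/

noncomputable section

open Matrix Finset
open scoped MatrixOrder

namespace Literature.Combinatorics.Optimization

/-! ### The normal form and its slack matrix -/

/-- `α = z₃ − w₃` (coordinates `z = (z 0, z 1, z 2) = (z₁,z₂,z₃)`). [cite: GouveiaRobinsonThomas2013, Thm. 4.8 proof (p11)] -/
def octaAlpha (z w : Fin 3 → ℝ) : ℝ := z 2 - w 2

/-- `β = w₁z₃ − z₁w₃`. [cite: GouveiaRobinsonThomas2013, Thm. 4.8 proof (p11)] -/
def octaBeta (z w : Fin 3 → ℝ) : ℝ := w 0 * z 2 - z 0 * w 2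

/-- `γ = w₂z₃ − z₂w₃`. [cite: GouveiaRobinsonThomas2013, Thm. 4.8 proof (p11)] -/
def octaGamma (z w : Fin 3 → ℝ) : ℝ := w 1 * z 2 - z 1 * w 2

/-- `E₃ = b(α−β) + (a−1)γ`, the numerator of the `(6,3)` entry of `S_O` (and, negated, of the `(5,7)`
entry: `b(β−α)+(1−a)γ = −E₃`). [cite: GouveiaRobinsonThomas2013, Thm. 4.8 proof (p11)] -/
def octaE3 (a b : ℝ) (z w : Fin 3 → ℝ) : ℝ := b * (octaAlpha z w - octaBeta z w) + (a - 1) * octaGamma z w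

/-- `E₄ = a(α−γ) + (b−1)β`, the numerator of the `(6,4)` entry of `S_O` (and, negated, of the `(5,8)`
entry). [cite: GouveiaRobinsonThomas2013, Thm. 4.8 proof (p11)] -/
def octaE4 (a b : ℝ) (z w : Fin 3 → ℝ) : ℝ := a * (octaAlpha z w - octaGamma z w) + (b - 1) * octaBeta z w

/-- **The slack matrix `S_O` of GRT Theorem 4.8** (p11, verbatim display quoted in the module
docstring), rows = the vertices `(0,0,0),(1,0,0),(0,1,0),(a,b,0),z,w`, columns = the eight facets
(the four through `z`, then the four through `w`); the printed entries `(b(β−α)+(1−a)γ)/w₃` and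
`(a(γ−α)+(1−b)β)/w₃` are written `−E₃/w₃`, `−E₄/w₃`. [cite: GouveiaRobinsonThomas2013, Thm. 4.8 proof (p11)] -/
def planarOctahedronSlack (a b : ℝ) (z w : Fin 3 → ℝ) : Matrix (Fin 6) (Fin 8) ℝ :=
  !![0, 0, b, a, 0, 0, b, a;
     1, 0, 0, a + b - 1, 1, 0, 0, a + b - 1;
     0, 1, a + b - 1, 0, 0, 1, a + b - 1, 0;
     a, b, 0, 0, a, b, 0, 0;
     0, 0, 0, 0, -octaBeta z w / w 2, -octaGamma z w / w 2, -octaE3 a b z w / w 2, -octaE4 a b z w / w 2;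
     octaBeta z w / z 2, octaGamma z w / z 2, octaE3 a b z w / z 2, octaE4 a b z w / z 2, 0, 0, 0, 0]

/-- The six vertices of the normal form. [cite: GouveiaRobinsonThomas2013, Thm. 4.8 proof (p11)] -/
def planarOctahedronVertices (a b : ℝ) (z w : Fin 3 → ℝ) : Fin 6 → Fin 3 → ℝ :=
  ![![0, 0, 0], ![1, 0, 0], ![0, 1, 0], ![a, b, 0], z, w]

/-- The eight facet inequalities `a_jᵀx ≤ b_j` (normals), scaled as in the printed `S_O`: the facets
`{0,e₂,z}`, `{0,e₁,z}`, `{e₁,(a,b,0),z}`, `{e₂,(a,b,0),z}` and the same four with `w` in place of `z`.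
[cite: GouveiaRobinsonThomas2013, Thm. 4.8 proof (p11)] -/
def planarOctahedronNormals (a b : ℝ) (z w : Fin 3 → ℝ) : Fin 8 → Fin 3 → ℝ :=
  ![![-1, 0, z 0 / z 2], ![0, -1, z 1 / z 2], ![b, 1 - a, ((a - 1) * z 1 - b * z 0 + b) / z 2],
    ![1 - b, a, ((b - 1) * z 0 - a * z 1 + a) / z 2],
    ![-1, 0, w 0 / w 2], ![0, -1, w 1 / w 2], ![b, 1 - a, ((a - 1) * w 1 - b * w 0 + b) / w 2],
    ![1 - b, a, ((b - 1) * w 0 - a * w 1 + a) / w 2]]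

/-- The eight facet inequalities: right-hand sides `0, 0, b, a, 0, 0, b, a`.
[cite: GouveiaRobinsonThomas2013, Thm. 4.8 proof (p11)] -/
def planarOctahedronOffsets (a b : ℝ) : Fin 8 → ℝ := ![0, 0, b, a, 0, 0, b, a]

/-- "Now `O` has slack matrix `S_O`": the printed matrix is the slack matrix `(b_j − a_jᵀv_i)` of the
six vertices against the eight inequalities (`z₃, w₃ ≠ 0`). [cite: GouveiaRobinsonThomas2013, Thm. 4.8 proof (p11)] -/
theorem planarOctahedronSlack_eq_slack {a b : ℝ} {z w : Fin 3 → ℝ} (hz : z 2 ≠ 0) (hw : w 2 ≠ 0)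
    (i : Fin 6) (j : Fin 8) :
    planarOctahedronSlack a b z w i j =
      planarOctahedronOffsets a b j - planarOctahedronNormals a b z w j ⬝ᵥ planarOctahedronVertices a b z w i := by
  fin_cases i <;> fin_cases j <;>
    simp [planarOctahedronSlack, planarOctahedronOffsets, planarOctahedronNormals,
      planarOctahedronVertices, octaAlpha, octaBeta, octaGamma, octaE3, octaE4, dotProduct,
      Fin.sum_univ_three] <;>
    field_simp <;> ring

/-- "`(0,0,0)`, `(a,b,0)`, `z`, `w` are coplanar if and only if `bβ = aγ`": the `3 × 3` determinant
`det[(a,b,0); z; w]` (rows `(a,b,0) − 0`, `z − 0`, `w − 0`) equals `bβ − aγ`. [cite: GouveiaRobinsonThomas2013, Thm. 4.8 proof (p11)] -/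
theorem det_planarity_one (a b : ℝ) (z w : Fin 3 → ℝ) :
    Matrix.det !![a, b, 0; z 0, z 1, z 2; w 0, w 1, w 2] = b * octaBeta z w - a * octaGamma z w := by
  rw [Matrix.det_fin_three]
  simp [octaBeta, octaGamma]
  ring

/-- "`(1,0,0)`, `(0,1,0)`, `z`, `w` are coplanar if and only if `α = β + γ`": the `3 × 3` determinant
`det[e₂ − e₁; z − e₁; w − e₁]` equals `β + γ − α`. [cite: GouveiaRobinsonThomas2013, Thm. 4.8 proof (p11)] -/
theorem det_planarity_two (z w : Fin 3 → ℝ) :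
    Matrix.det !![-1, 1, 0; z 0 - 1, z 1, z 2; w 0 - 1, w 1, w 2] =
      octaBeta z w + octaGamma z w - octaAlpha z w := by
  rw [Matrix.det_fin_three]
  simp [octaAlpha, octaBeta, octaGamma]
  ring

/-- The printed side conditions under which `S_O` is the slack matrix of an octahedron with the six
normal-form vertices: `z₃ > 0`, `w₃ < 0`, `a + b > 1` (printed), `a, b > 0`, and the four slacks
`β, γ, E₃, E₄` of `z` and `w` off the facets not containing them positive (convex position).
[cite: GouveiaRobinsonThomas2013, Thm. 4.8 proof (p11)] -/
structure PlanarOctahedronHyp (a b : ℝ) (z w : Fin 3 → ℝ) : Prop where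
  a_pos : 0 < a
  b_pos : 0 < b
  one_lt : 1 < a + b
  z_pos : 0 < z 2
  w_neg : w 2 < 0
  beta_pos : 0 < octaBeta z w
  gamma_pos : 0 < octaGamma z w
  e3_pos : 0 < octaE3 a b z w
  e4_pos : 0 < octaE4 a b z w

/-- The support of `S_O` as a `0/1` table (`1` = nonzero): the vertex–facet NON-incidences of the
octahedron. [cite: GouveiaRobinsonThomas2013, Thm. 4.8 proof (p11)] -/
def planarOctahedronSupport : Fin 6 → Fin 8 → ℕ :=
  ![![0, 0, 1, 1, 0, 0, 1, 1], ![1, 0, 0, 1, 1, 0, 0, 1], ![0, 1, 1, 0, 0, 1, 1, 0],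
    ![1, 1, 0, 0, 1, 1, 0, 0], ![0, 0, 0, 0, 1, 1, 1, 1], ![1, 1, 1, 1, 0, 0, 0, 0]]

namespace PlanarOctahedronHyp

variable {a b : ℝ} {z w : Fin 3 → ℝ} (h : PlanarOctahedronHyp a b z w)
include h

/-- `μ = −z₃/w₃ > 0`. [cite: GouveiaRobinsonThomas2013, Thm. 4.8 proof (p11)] -/
theorem mu_pos : 0 < -z 2 / w 2 := div_pos_of_neg_of_neg (by linarith [h.z_pos]) h.w_neg

/-- Every entry of `S_O` is the indicated multiple of a positive quantity; in particular
`S_O ≥ 0` entrywise. [cite: GouveiaRobinsonThomas2013, Thm. 4.8 proof (p11)] -/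
theorem nonneg (i : Fin 6) (j : Fin 8) : 0 ≤ planarOctahedronSlack a b z w i j := by
  have := h.a_pos; have := h.b_pos; have := h.one_lt; have := h.z_pos; have := h.w_neg
  have := h.beta_pos; have := h.gamma_pos; have := h.e3_pos; have := h.e4_pos
  have hn : ∀ X : ℝ, 0 < X → 0 ≤ -X / w 2 := fun X hX =>
    (div_pos_of_neg_of_neg (neg_neg_of_pos hX) h.w_neg).le
  fin_cases i <;> fin_cases j <;> simp [planarOctahedronSlack] <;>
    first | positivity | linarith | exact hn _ ‹_›

/-- The zero pattern of `S_O` is the octahedral incidence table `planarOctahedronSupport`.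
[cite: GouveiaRobinsonThomas2013, Thm. 4.8 proof (p11)] -/
theorem eq_zero_iff (i : Fin 6) (j : Fin 8) :
    planarOctahedronSlack a b z w i j = 0 ↔ planarOctahedronSupport i j = 0 := by
  have := h.a_pos; have := h.b_pos; have := h.one_lt; have := h.z_pos; have := h.w_neg
  have := h.beta_pos; have := h.gamma_pos; have := h.e3_pos; have := h.e4_pos
  have hz : z 2 ≠ 0 := ne_of_gt h.z_pos
  have hw : w 2 ≠ 0 := ne_of_lt h.w_neg
  fin_cases i <;> fin_cases j <;> simp [planarOctahedronSlack, planarOctahedronSupport, hz, hw] <;>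
    positivity

/-! ### Rank and the support-based lower bound -/

/-- `rank S_O = 4`: `≤ 4` since a slack matrix of points in `ℝ³` factors through `ℝ⁴`
(`[1 | v_i]·[b_j ; −a_j]`), `≥ 4` by the upper triangular minor on rows `(3,5,1,0)` × columns
`(5,1,0,2)` with diagonal `b, γ/z₃, 1, b`. [cite: GouveiaRobinsonThomas2013, Thm. 4.8 proof (p11)] -/
theorem rank_eq_four : (planarOctahedronSlack a b z w).rank = 4 := by
  have hz : z 2 ≠ 0 := ne_of_gt h.z_pos
  have hw : w 2 ≠ 0 := ne_of_lt h.w_neg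
  refine le_antisymm ?_ ?_
  · let U : Matrix (Fin 6) (Fin 4) ℝ := Matrix.of fun i =>
      ![1, planarOctahedronVertices a b z w i 0, planarOctahedronVertices a b z w i 1,
        planarOctahedronVertices a b z w i 2]
    let V : Matrix (Fin 4) (Fin 8) ℝ := Matrix.of fun l j =>
      ![planarOctahedronOffsets a b j, -planarOctahedronNormals a b z w j 0,
        -planarOctahedronNormals a b z w j 1, -planarOctahedronNormals a b z w j 2] l
    have hUV : planarOctahedronSlack a b z w = U * V := by
      ext i j
      rw [Matrix.mul_apply, planarOctahedronSlack_eq_slack hz hw, Fin.sum_univ_four]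
      simp [U, V, dotProduct, Fin.sum_univ_three]
      ring
    rw [hUV]
    exact (Matrix.rank_mul_le_right _ _).trans (Matrix.rank_le_height V)
  · have hU : (planarOctahedronSlack a b z w).submatrix (![3, 5, 1, 0] : Fin 4 → Fin 6)
        (![5, 1, 0, 2] : Fin 4 → Fin 8) =
        !![b, b, a, 0; 0, octaGamma z w / z 2, octaBeta z w / z 2, octaE3 a b z w / z 2;
           0, 0, 1, 0; 0, 0, 0, b] := by
      ext i j
      fin_cases i <;> fin_cases j <;> simp [planarOctahedronSlack]
    have hT : Matrix.BlockTriangular (!![b, b, a, 0; 0, octaGamma z w / z 2, octaBeta z w / z 2,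
        octaE3 a b z w / z 2; 0, 0, 1, 0; 0, 0, 0, b] : Matrix (Fin 4) (Fin 4) ℝ) id := by
      intro i j hij
      fin_cases i <;> fin_cases j <;> first | exact absurd hij (by decide) | simp
    have hdet : 0 < ((planarOctahedronSlack a b z w).submatrix (![3, 5, 1, 0] : Fin 4 → Fin 6)
        (![5, 1, 0, 2] : Fin 4 → Fin 8)).det := by
      have := h.b_pos; have := h.gamma_pos; have := h.z_pos
      rw [hU, Matrix.det_of_upperTriangular hT, Fin.prod_univ_four]
      simp
      positivity
    simpa using Literature.LinearAlgebra.Matrix.card_le_rank_of_det_submatrix_ne_zero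
      (planarOctahedronSlack a b z w) _ _ (ne_of_gt hdet)

/-- `rank_psd S_O ≥ 4` (GRT Prop. 3.2 / FGPRT Cor. 5.9 for a `3`-polytope; here from the triangular
`4`-pattern rows `(0,1,5,3)` × columns `(2,0,1,5)` of the octahedral support).
[cite: GouveiaRobinsonThomas2013, Thm. 4.8 (p11) with Prop. 3.2 (p07)] -/
theorem four_le_of_hasPsdFactorization {k : ℕ}
    (hk : HasPsdFactorization (planarOctahedronSlack a b z w) k) : 4 ≤ k :=
  hk.card_le_of_triangular ![0, 1, 5, 3] ![2, 0, 1, 5]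
    (fun i hi => by
      have h' : ∀ i : Fin 4, planarOctahedronSupport (![0, 1, 5, 3] i) (![2, 0, 1, 5] i) ≠ 0 := by
        decide
      exact h' i ((h.eq_zero_iff _ _).mp hi))
    (fun i j hij => (h.eq_zero_iff _ _).mpr (by
      have h' : ∀ i j : Fin 4, i < j →
          planarOctahedronSupport (![0, 1, 5, 3] i) (![2, 0, 1, 5] j) = 0 := by decide
      exact h' i j hij))

/-- In a psd factorization of SIZE FOUR of `S_O`, every factor has rank `≤ 1` (GRT Prop. 3.2 for this
`3`-polytope, obtained from Prop. 2.6's compression and the triangular `3`-patterns of the octahedral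
support: `rank_rowFactor_add_le_of_triangular`, `rank_colFactor_add_le_of_triangular`).
[cite: GouveiaRobinsonThomas2013, Thm. 4.8 (p11–p12) with Prop. 3.2 (p07)] -/
theorem factors_rank_le_one (A : Fin 6 → Matrix (Fin 4) (Fin 4) ℝ)
    (B : Fin 8 → Matrix (Fin 4) (Fin 4) ℝ) (hA : ∀ i, (A i).PosSemidef) (hB : ∀ j, (B j).PosSemidef)
    (hM : ∀ i j, planarOctahedronSlack a b z w i j = (A i * B j).trace) :
    (∀ i, (A i).rank ≤ 1) ∧ ∀ j, (B j).rank ≤ 1 := by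
  have row : ∀ (r : Fin 6) (ρ : Fin 3 → Fin 6) (γ : Fin 3 → Fin 8),
      (∀ t, planarOctahedronSupport r (γ t) = 0) → (∀ t, planarOctahedronSupport (ρ t) (γ t) ≠ 0) →
      (∀ s t, s < t → planarOctahedronSupport (ρ s) (γ t) = 0) → (A r).rank ≤ 1 := by
    intro r ρ γ h1 h2 h3
    have h' := rank_rowFactor_add_le_of_triangular A B hA hB hM r ρ γ
      (fun t => (h.eq_zero_iff _ _).mpr (h1 t))
      (fun t ht => h2 t ((h.eq_zero_iff _ _).mp ht))
      (fun s t hst => (h.eq_zero_iff _ _).mpr (h3 s t hst))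
    omega
  have col : ∀ (c : Fin 8) (ρ : Fin 3 → Fin 6) (γ : Fin 3 → Fin 8),
      (∀ t, planarOctahedronSupport (ρ t) c = 0) → (∀ t, planarOctahedronSupport (ρ t) (γ t) ≠ 0) →
      (∀ s t, s < t → planarOctahedronSupport (ρ s) (γ t) = 0) → (B c).rank ≤ 1 := by
    intro c ρ γ h1 h2 h3
    have h' := rank_colFactor_add_le_of_triangular A B hA hB hM c ρ γ
      (fun t => (h.eq_zero_iff _ _).mpr (h1 t))
      (fun t ht => h2 t ((h.eq_zero_iff _ _).mp ht))
      (fun s t hst => (h.eq_zero_iff _ _).mpr (h3 s t hst))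
    omega
  refine ⟨fun i => ?_, fun j => ?_⟩
  · fin_cases i
    · exact row 0 ![1, 5, 2] ![0, 1, 5] (by decide) (by decide) (by decide)
    · exact row 1 ![3, 5, 0] ![1, 2, 6] (by decide) (by decide) (by decide)
    · exact row 2 ![3, 5, 0] ![0, 3, 7] (by decide) (by decide) (by decide)
    · exact row 3 ![2, 5, 0] ![2, 3, 7] (by decide) (by decide) (by decide)
    · exact row 4 ![1, 3, 0] ![0, 1, 2] (by decide) (by decide) (by decide)
    · exact row 5 ![1, 3, 0] ![4, 5, 6] (by decide) (by decide) (by decide)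
  · fin_cases j
    · exact col 0 ![0, 2, 4] ![2, 1, 4] (by decide) (by decide) (by decide)
    · exact col 1 ![0, 1, 4] ![2, 0, 5] (by decide) (by decide) (by decide)
    · exact col 2 ![1, 3, 4] ![0, 1, 6] (by decide) (by decide) (by decide)
    · exact col 3 ![2, 3, 4] ![1, 0, 7] (by decide) (by decide) (by decide)
    · exact col 4 ![0, 2, 5] ![2, 1, 0] (by decide) (by decide) (by decide)
    · exact col 5 ![0, 1, 5] ![2, 0, 1] (by decide) (by decide) (by decide)
    · exact col 6 ![1, 3, 5] ![0, 1, 2] (by decide) (by decide) (by decide)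
    · exact col 7 ![2, 3, 5] ![1, 0, 3] (by decide) (by decide) (by decide)

end PlanarOctahedronHyp

/-! ### The positive square root: rank `≤ 5` always, rank `≤ 4` in the biplanar cases -/

/-- `⁺√S_O`, the positive Hadamard square root. [cite: GouveiaRobinsonThomas2013, Thm. 4.8 proof (p12)] -/
def planarOctahedronSqrt (a b : ℝ) (z w : Fin 3 → ℝ) : Matrix (Fin 6) (Fin 8) ℝ :=
  fun i j => Real.sqrt (planarOctahedronSlack a b z w i j)

/-- The row relation among the first four rows of `⁺√S_O` (the four coplanar vertices):
`r₄ = −√(a+b−1)·r₁ + √a·r₂ + √b·r₃`. [cite: GouveiaRobinsonThomas2013, Thm. 4.8 proof (p12, "row reduction")] -/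
theorem planarOctahedronSqrt_row_three (a b : ℝ) (z w : Fin 3 → ℝ) (j : Fin 8) :
    planarOctahedronSqrt a b z w 3 j = -Real.sqrt (a + b - 1) * planarOctahedronSqrt a b z w 0 j +
      Real.sqrt a * planarOctahedronSqrt a b z w 1 j + Real.sqrt b * planarOctahedronSqrt a b z w 2 j := by
  fin_cases j <;> simp [planarOctahedronSqrt, planarOctahedronSlack] <;> ring

/-- The algebraic identity behind both planarity cases: `aE₃ − bE₄ = (a+b−1)(aγ − bβ)`.
[cite: GouveiaRobinsonThomas2013, Thm. 4.8 proof (p11–p12)] -/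
theorem octaE3_octaE4_identity (a b : ℝ) (z w : Fin 3 → ℝ) :
    a * octaE3 a b z w - b * octaE4 a b z w = (a + b - 1) * (a * octaGamma z w - b * octaBeta z w) := by
  simp only [octaE3, octaE4]; ring

namespace PlanarOctahedronHyp

variable {a b : ℝ} {z w : Fin 3 → ℝ} (h : PlanarOctahedronHyp a b z w)
include h

/-- `⁺√S_O ∘ ⁺√S_O = S_O`. [cite: GouveiaRobinsonThomas2013, Thm. 4.8 proof (p12)] -/
theorem sqrt_sq (i : Fin 6) (j : Fin 8) :
    planarOctahedronSqrt a b z w i j ^ 2 = planarOctahedronSlack a b z w i j :=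
  Real.sq_sqrt (h.nonneg i j)

/-- Hence `⁺√S_O = U · (rows 1,2,3,5,6 of ⁺√S_O)` has rank `≤ 5`, and `rank_psd S_O ≤ 5`, for EVERY
octahedron in the normal form. [cite: GouveiaRobinsonThomas2013, Thm. 4.8 proof (p12)] -/
theorem hasPsdFactorization_five : HasPsdFactorization (planarOctahedronSlack a b z w) 5 := by
  have hmul : planarOctahedronSqrt a b z w =
      !![1, 0, 0, 0, 0; 0, 1, 0, 0, 0; 0, 0, 1, 0, 0;
         -Real.sqrt (a + b - 1), Real.sqrt a, Real.sqrt b, 0, 0; 0, 0, 0, 1, 0; 0, 0, 0, 0, 1] *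
        (planarOctahedronSqrt a b z w).submatrix (![0, 1, 2, 4, 5] : Fin 5 → Fin 6) id := by
    ext i j
    fin_cases i
    · simp [Matrix.mul_apply, Fin.sum_univ_five]
    · simp [Matrix.mul_apply, Fin.sum_univ_five]
    · simp [Matrix.mul_apply, Fin.sum_univ_five]
    · rw [Matrix.mul_apply, Fin.sum_univ_five]
      simp only [Matrix.submatrix_apply, id]
      simp [planarOctahedronSqrt_row_three]
    · simp [Matrix.mul_apply, Fin.sum_univ_five]
    · simp [Matrix.mul_apply, Fin.sum_univ_five]
  refine HasHadamardSqrtOfRankLE.hasPsdFactorization ⟨planarOctahedronSqrt a b z w, h.sqrt_sq, ?_⟩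
  rw [hmul]
  exact (Matrix.rank_mul_le_right _ _).trans (Matrix.rank_le_height _)

/-- The entries of row `5` are `√μ` times those of row `6`: `√(−X/w₃) = √(−z₃/w₃) · √(X/z₃)`.
[cite: GouveiaRobinsonThomas2013, Thm. 4.8 proof (p12)] -/
theorem sqrt_neg_div (X : ℝ) :
    Real.sqrt (-X / w 2) = Real.sqrt (-z 2 / w 2) * Real.sqrt (X / z 2) := by
  have hz : z 2 ≠ 0 := ne_of_gt h.z_pos
  have hw : w 2 ≠ 0 := ne_of_lt h.w_neg
  rw [← Real.sqrt_mul h.mu_pos.le]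
  congr 1
  field_simp

/-- **The key identity of the "row reduction"**: in either planarity case,
`√(a+b−1)·(√a·√(γ/z₃) − √b·√(β/z₃)) = √a·√(E₃/z₃) − √b·√(E₄/z₃)`
(under `bβ = aγ` both sides are `0` since also `aE₃ = bE₄`; under `α = β+γ`, `E₃ = (a+b−1)γ` and
`E₄ = (a+b−1)β`). [cite: GouveiaRobinsonThomas2013, Thm. 4.8 proof (p12, "row reduction shows that ⁺√S_O has rank four")] -/
theorem sqrt_key (hpl : b * octaBeta z w = a * octaGamma z w ∨ octaAlpha z w = octaBeta z w + octaGamma z w) :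
    Real.sqrt (a + b - 1) * (Real.sqrt a * Real.sqrt (octaGamma z w / z 2) -
        Real.sqrt b * Real.sqrt (octaBeta z w / z 2)) =
      Real.sqrt a * Real.sqrt (octaE3 a b z w / z 2) - Real.sqrt b * Real.sqrt (octaE4 a b z w / z 2) := by
  have ha := h.a_pos.le; have hb := h.b_pos.le
  have hz : z 2 ≠ 0 := ne_of_gt h.z_pos
  have ht : 0 ≤ a + b - 1 := by linarith [h.one_lt]
  rcases hpl with h1 | h2
  · -- `bβ = aγ`: `√b√(β/z₃) = √a√(γ/z₃)` and `√a√(E₃/z₃) = √b√(E₄/z₃)`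
    have hE : a * octaE3 a b z w = b * octaE4 a b z w := by
      have := octaE3_octaE4_identity a b z w
      rw [← h1] at this
      linarith [this, show (a + b - 1) * (b * octaBeta z w - b * octaBeta z w) = 0 by ring]
    have e1 : Real.sqrt a * Real.sqrt (octaGamma z w / z 2) = Real.sqrt b * Real.sqrt (octaBeta z w / z 2) := by
      rw [← Real.sqrt_mul ha, ← Real.sqrt_mul hb]
      congr 1
      field_simp
      linarith
    have e2 : Real.sqrt a * Real.sqrt (octaE3 a b z w / z 2) = Real.sqrt b * Real.sqrt (octaE4 a b z w / z 2) := by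
      rw [← Real.sqrt_mul ha, ← Real.sqrt_mul hb]
      congr 1
      field_simp
      linarith
    rw [e1, e2, sub_self, sub_self, mul_zero]
  · -- `α = β + γ`: `E₃ = (a+b−1)γ`, `E₄ = (a+b−1)β`
    have hE3 : octaE3 a b z w = (a + b - 1) * octaGamma z w := by
      simp only [octaE3, h2]; ring
    have hE4 : octaE4 a b z w = (a + b - 1) * octaBeta z w := by
      simp only [octaE4, h2]; ring
    rw [hE3, hE4, mul_div_assoc, mul_div_assoc, Real.sqrt_mul ht, Real.sqrt_mul ht]
    ring

/-- **"row reduction shows that `⁺√S_O` has rank four"**, the row relation it rests on: in either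
planarity case row `5` of `⁺√S_O` is a combination of rows `1, 2, 3, 6`,
`r₅ = p₁r₁ + √μ√(β/z₃)·r₂ + √μ√(γ/z₃)·r₃ − √μ·r₆` with `√μ = √(−z₃/w₃)` and
`p₁ = −√μ(√(a+b−1)√(γ/z₃) − √(E₃/z₃))/√b`. [cite: GouveiaRobinsonThomas2013, Thm. 4.8 proof (p12)] -/
theorem sqrt_row_four (hpl : b * octaBeta z w = a * octaGamma z w ∨ octaAlpha z w = octaBeta z w + octaGamma z w)
    (j : Fin 8) :
    planarOctahedronSqrt a b z w 4 j =
      (-Real.sqrt (-z 2 / w 2) * (Real.sqrt (a + b - 1) * Real.sqrt (octaGamma z w / z 2) -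
          Real.sqrt (octaE3 a b z w / z 2)) / Real.sqrt b) * planarOctahedronSqrt a b z w 0 j +
      Real.sqrt (-z 2 / w 2) * Real.sqrt (octaBeta z w / z 2) * planarOctahedronSqrt a b z w 1 j +
      Real.sqrt (-z 2 / w 2) * Real.sqrt (octaGamma z w / z 2) * planarOctahedronSqrt a b z w 2 j -
      Real.sqrt (-z 2 / w 2) * planarOctahedronSqrt a b z w 5 j := by
  have hb0 : Real.sqrt b ≠ 0 := Real.sqrt_ne_zero'.mpr h.b_pos
  have hkey := h.sqrt_key hpl
  have hnd := h.sqrt_neg_div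
  set ν := Real.sqrt (-z 2 / w 2) with hν
  fin_cases j <;> simp [planarOctahedronSqrt, planarOctahedronSlack]
  · -- column 2: `0 = p₁√b + p₃√(a+b−1) − √μ√(E₃/z₃)`
    field_simp
    ring
  · -- column 3: `0 = p₁√a + p₂√(a+b−1) − √μ√(E₄/z₃)`, by the key identity
    field_simp
    linear_combination ν * hkey
  · -- column 4: `√(−β/w₃) = √μ√(β/z₃)`
    exact hnd _
  · -- column 5
    exact hnd _
  · -- column 6: `√(−E₃/w₃) = p₁√b + p₃√(a+b−1) = √μ√(E₃/z₃)`
    rw [hnd]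
    field_simp
    ring
  · -- column 7: `√(−E₄/w₃) = p₁√a + p₂√(a+b−1) = √μ√(E₄/z₃)` by the key identity
    rw [hnd]
    field_simp
    linear_combination ν * hkey

/-- **Theorem 4.8 ⇐, square-root form**: in either planarity case `⁺√S_O` has rank `≤ 4`
(`⁺√S_O = U · (rows 1,2,3,6 of ⁺√S_O)`). [cite: GouveiaRobinsonThomas2013, Thm. 4.8 (p11–p12)] -/
theorem hasHadamardSqrtOfRankLE_four
    (hpl : b * octaBeta z w = a * octaGamma z w ∨ octaAlpha z w = octaBeta z w + octaGamma z w) :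
    HasHadamardSqrtOfRankLE (planarOctahedronSlack a b z w) 4 := by
  refine ⟨planarOctahedronSqrt a b z w, h.sqrt_sq, ?_⟩
  have hmul : planarOctahedronSqrt a b z w =
      !![1, 0, 0, 0; 0, 1, 0, 0; 0, 0, 1, 0; -Real.sqrt (a + b - 1), Real.sqrt a, Real.sqrt b, 0;
         -Real.sqrt (-z 2 / w 2) * (Real.sqrt (a + b - 1) * Real.sqrt (octaGamma z w / z 2) -
            Real.sqrt (octaE3 a b z w / z 2)) / Real.sqrt b,
          Real.sqrt (-z 2 / w 2) * Real.sqrt (octaBeta z w / z 2),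
          Real.sqrt (-z 2 / w 2) * Real.sqrt (octaGamma z w / z 2), -Real.sqrt (-z 2 / w 2);
         0, 0, 0, 1] *
        (planarOctahedronSqrt a b z w).submatrix (![0, 1, 2, 5] : Fin 4 → Fin 6) id := by
    ext i j
    fin_cases i
    · simp [Matrix.mul_apply, Fin.sum_univ_four]
    · simp [Matrix.mul_apply, Fin.sum_univ_four]
    · simp [Matrix.mul_apply, Fin.sum_univ_four]
    · rw [Matrix.mul_apply, Fin.sum_univ_four]
      simp only [Matrix.submatrix_apply, id]
      simp [planarOctahedronSqrt_row_three]
    · simp [Matrix.mul_apply, Fin.sum_univ_four, h.sqrt_row_four hpl]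
      ring
    · simp [Matrix.mul_apply, Fin.sum_univ_four]
  rw [hmul]
  exact (Matrix.rank_mul_le_right _ _).trans (Matrix.rank_le_height _)

/-- **GRT Theorem 4.8, "if" direction** (p11–p12): "First, assume `O` is biplanar … In the case
`bβ = aγ` or the case `α = β + γ` … `O` has psd rank four." For the normal form: `S_O` has a psd
factorization of size `4` (and none smaller, `four_le_of_hasPsdFactorization`).
[cite: GouveiaRobinsonThomas2013, Thm. 4.8 (p11–p12)] -/
theorem hasPsdFactorization_four
    (hpl : b * octaBeta z w = a * octaGamma z w ∨ octaAlpha z w = octaBeta z w + octaGamma z w) :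
    HasPsdFactorization (planarOctahedronSlack a b z w) 4 :=
  (h.hasHadamardSqrtOfRankLE_four hpl).hasPsdFactorization

/-! ### The converse for the normal form: no further planarity forces `rank_√ ≥ 5` -/

/-- **Theorem 4.8 ⇒ for the normal form, square-root form**: if neither `bβ = aγ` nor `α = β + γ`,
then for EVERY `N` with `N ∘ N = S_O` the rows `1,2,3,5,6` of `N` are linearly independent (the
sign-free elimination of the module docstring: `X + V = Y + U` and `X² + V² = Y² + U²` force
`(X−Y)(X−U) = 0`, i.e. one of the two planarities). [cite: GouveiaRobinsonThomas2013, Thm. 4.8 (p11–p12)] -/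
theorem linearIndependent_rows_of_sq_eq (h1 : b * octaBeta z w ≠ a * octaGamma z w)
    (h2 : octaAlpha z w ≠ octaBeta z w + octaGamma z w) (N : Matrix (Fin 6) (Fin 8) ℝ)
    (hN : ∀ i j, N i j ^ 2 = planarOctahedronSlack a b z w i j) :
    LinearIndependent ℝ (fun k : Fin 5 => N ((![0, 1, 2, 4, 5] : Fin 5 → Fin 6) k)) := by
  have ha := h.a_pos; have hb := h.b_pos; have ht : 0 < a + b - 1 := by linarith [h.one_lt]
  have hz : z 2 ≠ 0 := ne_of_gt h.z_pos
  have hw : w 2 ≠ 0 := ne_of_lt h.w_neg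
  rw [Fintype.linearIndependent_iff]
  intro g hg
  have hcol : ∀ j, g 0 * N 0 j + g 1 * N 1 j + g 2 * N 2 j + g 3 * N 4 j + g 4 * N 5 j = 0 := by
    intro j
    have := congrFun hg j
    simpa [Fin.sum_univ_five] using this
  -- zero entries
  have hzr : ∀ i j, planarOctahedronSupport i j = 0 → N i j = 0 := fun i j hij => by
    have := hN i j
    rw [(h.eq_zero_iff i j).mpr hij] at this
    exact (pow_eq_zero_iff two_ne_zero).mp this
  have z00 : N 0 0 = 0 := hzr 0 0 (by decide)
  have z01 : N 0 1 = 0 := hzr 0 1 (by decide)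
  have z04 : N 0 4 = 0 := hzr 0 4 (by decide)
  have z11 : N 1 1 = 0 := hzr 1 1 (by decide)
  have z12 : N 1 2 = 0 := hzr 1 2 (by decide)
  have z20 : N 2 0 = 0 := hzr 2 0 (by decide)
  have z23 : N 2 3 = 0 := hzr 2 3 (by decide)
  have z24 : N 2 4 = 0 := hzr 2 4 (by decide)
  have z40 : N 4 0 = 0 := hzr 4 0 (by decide)
  have z41 : N 4 1 = 0 := hzr 4 1 (by decide)
  have z42 : N 4 2 = 0 := hzr 4 2 (by decide)
  have z43 : N 4 3 = 0 := hzr 4 3 (by decide)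
  have z54 : N 5 4 = 0 := hzr 5 4 (by decide)
  -- squares of the entries used
  have e10 : N 1 0 ^ 2 = 1 := by rw [hN]; simp [planarOctahedronSlack]
  have e21 : N 2 1 ^ 2 = 1 := by rw [hN]; simp [planarOctahedronSlack]
  have e14 : N 1 4 ^ 2 = 1 := by rw [hN]; simp [planarOctahedronSlack]
  have e02 : N 0 2 ^ 2 = b := by rw [hN]; simp [planarOctahedronSlack]
  have e03 : N 0 3 ^ 2 = a := by rw [hN]; simp [planarOctahedronSlack]
  have e22 : N 2 2 ^ 2 = a + b - 1 := by rw [hN]; simp [planarOctahedronSlack]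
  have e13 : N 1 3 ^ 2 = a + b - 1 := by rw [hN]; simp [planarOctahedronSlack]
  have e50 : N 5 0 ^ 2 = octaBeta z w / z 2 := by rw [hN]; simp [planarOctahedronSlack]
  have e51 : N 5 1 ^ 2 = octaGamma z w / z 2 := by rw [hN]; simp [planarOctahedronSlack]
  have e52 : N 5 2 ^ 2 = octaE3 a b z w / z 2 := by rw [hN]; simp [planarOctahedronSlack]
  have e53 : N 5 3 ^ 2 = octaE4 a b z w / z 2 := by rw [hN]; simp [planarOctahedronSlack]
  have e44 : N 4 4 ^ 2 = -octaBeta z w / w 2 := by rw [hN]; simp [planarOctahedronSlack]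
  -- coefficients
  obtain ⟨p, hp⟩ : ∃ p, p = g 0 := ⟨_, rfl⟩
  obtain ⟨q, hq⟩ : ∃ q, q = g 1 := ⟨_, rfl⟩
  obtain ⟨r, hr⟩ : ∃ r, r = g 2 := ⟨_, rfl⟩
  obtain ⟨e, he⟩ : ∃ e, e = g 3 := ⟨_, rfl⟩
  obtain ⟨f, hf⟩ : ∃ f, f = g 4 := ⟨_, rfl⟩
  rw [← hp, ← hq, ← hr, ← he, ← hf] at hcol
  have c0 : q * N 1 0 + f * N 5 0 = 0 := by have := hcol 0; rw [z00, z20, z40] at this; linarith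
  have c1 : r * N 2 1 + f * N 5 1 = 0 := by have := hcol 1; rw [z01, z11, z41] at this; linarith
  have c2 : p * N 0 2 + r * N 2 2 + f * N 5 2 = 0 := by
    have := hcol 2; rw [z12, z42] at this; linarith
  have c3 : p * N 0 3 + q * N 1 3 + f * N 5 3 = 0 := by
    have := hcol 3; rw [z23, z43] at this; linarith
  have c4 : q * N 1 4 + e * N 4 4 = 0 := by have := hcol 4; rw [z04, z24, z54] at this; linarith
  -- `q = −f N₅₀ N₁₀`, `r = −f N₅₁ N₂₁`
  have hq' : q = -(f * N 5 0 * N 1 0) := by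
    have : q * N 1 0 ^ 2 + f * N 5 0 * N 1 0 = 0 := by linear_combination N 1 0 * c0
    rw [e10] at this; linarith
  have hr' : r = -(f * N 5 1 * N 2 1) := by
    have : r * N 2 1 ^ 2 + f * N 5 1 * N 2 1 = 0 := by linear_combination N 2 1 * c1
    rw [e21] at this; linarith
  -- the four signed products
  obtain ⟨X, hX⟩ : ∃ X, X = N 0 3 * N 5 1 * N 2 1 * N 2 2 := ⟨_, rfl⟩
  obtain ⟨U, hU⟩ : ∃ U, U = N 0 3 * N 5 2 := ⟨_, rfl⟩
  obtain ⟨Y, hY⟩ : ∃ Y, Y = N 0 2 * N 5 0 * N 1 0 * N 1 3 := ⟨_, rfl⟩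
  obtain ⟨V, hV⟩ : ∃ V, V = N 0 2 * N 5 3 := ⟨_, rfl⟩
  have hX2 : X ^ 2 = a * (octaGamma z w / z 2) * (a + b - 1) := by
    have : X ^ 2 = N 0 3 ^ 2 * N 5 1 ^ 2 * N 2 1 ^ 2 * N 2 2 ^ 2 := by rw [hX]; ring
    rw [this, e03, e51, e21, e22]; ring
  have hU2 : U ^ 2 = a * (octaE3 a b z w / z 2) := by
    have : U ^ 2 = N 0 3 ^ 2 * N 5 2 ^ 2 := by rw [hU]; ring
    rw [this, e03, e52]
  have hY2 : Y ^ 2 = b * (octaBeta z w / z 2) * (a + b - 1) := by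
    have : Y ^ 2 = N 0 2 ^ 2 * N 5 0 ^ 2 * N 1 0 ^ 2 * N 1 3 ^ 2 := by rw [hY]; ring
    rw [this, e02, e50, e10, e13]; ring
  have hV2 : V ^ 2 = b * (octaE4 a b z w / z 2) := by
    have : V ^ 2 = N 0 2 ^ 2 * N 5 3 ^ 2 := by rw [hV]; ring
    rw [this, e02, e53]
  -- `X² + V² = Y² + U²` (the identity `aE₃ − bE₄ = (a+b−1)(aγ − bβ)`)
  have hC : X ^ 2 + V ^ 2 = Y ^ 2 + U ^ 2 := by
    rw [hX2, hU2, hY2, hV2]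
    have hid := octaE3_octaE4_identity a b z w
    have key : a * (octaGamma z w / z 2) * (a + b - 1) + b * (octaE4 a b z w / z 2) -
        (b * (octaBeta z w / z 2) * (a + b - 1) + a * (octaE3 a b z w / z 2)) =
        -(a * octaE3 a b z w - b * octaE4 a b z w -
          (a + b - 1) * (a * octaGamma z w - b * octaBeta z w)) / z 2 := by
      ring
    rw [hid, sub_self, neg_zero, zero_div] at key
    linarith
  -- `f (X − U − Y + V) = 0`
  have hE : f * (X + V - Y - U) = 0 := by
    have h2' : p * N 0 2 * N 0 3 = f * N 0 3 * (N 5 1 * N 2 1 * N 2 2 - N 5 2) := by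
      have : p * N 0 2 = -(r * N 2 2) - f * N 5 2 := by linarith
      rw [this, hr']; ring
    have h3' : p * N 0 2 * N 0 3 = f * N 0 2 * (N 5 0 * N 1 0 * N 1 3 - N 5 3) := by
      have : p * N 0 3 = -(q * N 1 3) - f * N 5 3 := by linarith
      calc p * N 0 2 * N 0 3 = (p * N 0 3) * N 0 2 := by ring
        _ = _ := by rw [this, hq']; ring
    rw [hX, hU, hY, hV]
    linear_combination h3' - h2'
  -- if `f ≠ 0`: `X + V = Y + U`, hence `XV = YU`, hence `(X − Y)(X − U) = 0` — a planarity
  have hf0 : f = 0 := by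
    by_contra hf0
    have hlin : X + V = Y + U := by
      have := (mul_eq_zero.mp hE).resolve_left hf0
      linarith
    have hXV : X * V = Y * U := by
      have : (X + V) ^ 2 = (Y + U) ^ 2 := by rw [hlin]
      linear_combination (this - hC) / 2
    have hprod : (X - Y) * (X - U) = 0 := by
      linear_combination X * hlin - hXV
    rcases mul_eq_zero.mp hprod with hXY | hXU
    · -- `X = Y`: `aγ = bβ`
      have hsq : X ^ 2 = Y ^ 2 := by rw [sub_eq_zero.mp hXY]
      rw [hX2, hY2] at hsq
      have h' : (a * octaGamma z w - b * octaBeta z w) * ((a + b - 1) / z 2) = 0 := by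
        linear_combination hsq
      have hne : (a + b - 1) / z 2 ≠ 0 := div_ne_zero (ne_of_gt ht) hz
      have h'' := (mul_eq_zero.mp h').resolve_right hne
      exact h1 (by linarith)
    · -- `X = U`: `(a+b−1)γ = E₃`, i.e. `b(α − β − γ) = 0`
      have hsq : X ^ 2 = U ^ 2 := by rw [sub_eq_zero.mp hXU]
      rw [hX2, hU2] at hsq
      have h' : ((a + b - 1) * octaGamma z w - octaE3 a b z w) * (a / z 2) = 0 := by
        linear_combination hsq
      have hne : a / z 2 ≠ 0 := div_ne_zero (ne_of_gt ha) hz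
      have h'' := (mul_eq_zero.mp h').resolve_right hne
      have hE3 : octaE3 a b z w - (a + b - 1) * octaGamma z w =
          b * (octaAlpha z w - octaBeta z w - octaGamma z w) := by
        simp only [octaE3]; ring
      have hb0 : b * (octaAlpha z w - octaBeta z w - octaGamma z w) = 0 := by linarith
      have h3 := (mul_eq_zero.mp hb0).resolve_left (ne_of_gt hb)
      exact h2 (by linarith)
  -- then everything vanishes
  have hq0 : q = 0 := by rw [hq', hf0]; ring
  have hr0 : r = 0 := by rw [hr', hf0]; ring
  have hp0 : p = 0 := by
    have hc : p * N 0 2 = 0 := by rw [hr0, hf0] at c2; linarith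
    rcases mul_eq_zero.mp hc with hc | hc
    · exact hc
    · exfalso; rw [hc] at e02; linarith [e02]
  have he0 : e = 0 := by
    have hc : e * N 4 4 = 0 := by rw [hq0] at c4; linarith
    rcases mul_eq_zero.mp hc with hc | hc
    · exact hc
    · exfalso
      rw [hc] at e44
      have : 0 < -octaBeta z w / w 2 := div_pos_of_neg_of_neg (by linarith [h.beta_pos]) h.w_neg
      linarith [e44]
  intro k
  fin_cases k
  · simpa [← hp] using hp0
  · simpa [← hq] using hq0
  · simpa [← hr] using hr0
  · simpa [← he] using he0
  · simpa [← hf] using hf0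

/-- Hence, absent both planarities, every Hadamard square root of `S_O` has rank `≥ 5`.
[cite: GouveiaRobinsonThomas2013, Thm. 4.8 (p11–p12)] -/
theorem five_le_rank_of_sq_eq (h1 : b * octaBeta z w ≠ a * octaGamma z w)
    (h2 : octaAlpha z w ≠ octaBeta z w + octaGamma z w) (N : Matrix (Fin 6) (Fin 8) ℝ)
    (hN : ∀ i j, N i j ^ 2 = planarOctahedronSlack a b z w i j) : 5 ≤ N.rank := by
  have hli := h.linearIndependent_rows_of_sq_eq h1 h2 N hN
  have h5 : (N.submatrix (![0, 1, 2, 4, 5] : Fin 5 → Fin 6) id).rank = 5 := by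
    have := LinearIndependent.rank_matrix
      (M := N.submatrix (![0, 1, 2, 4, 5] : Fin 5 → Fin 6) id) (by exact hli)
    simpa using this
  calc 5 = (N.submatrix (![0, 1, 2, 4, 5] : Fin 5 → Fin 6) id).rank := h5.symm
    _ ≤ N.rank := Matrix.rank_submatrix_le N _ _

/-- `rank_√ S_O ≥ 5` absent both planarities. [cite: GouveiaRobinsonThomas2013, Thm. 4.8 (p11–p12)] -/
theorem not_hasHadamardSqrtOfRankLE_four (h1 : b * octaBeta z w ≠ a * octaGamma z w)
    (h2 : octaAlpha z w ≠ octaBeta z w + octaGamma z w) :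
    ¬ HasHadamardSqrtOfRankLE (planarOctahedronSlack a b z w) 4 := by
  rintro ⟨N, hN, hrk⟩
  have := h.five_le_rank_of_sq_eq h1 h2 N hN
  omega

/-- **GRT Theorem 4.8, "only if" direction for the normal form** (p12: "For the converse, suppose
`O` is planar to either one or zero planes … we must have `rank_psd O ≥ 5`"): if the octahedron
(planar with respect to the `xy` plane) satisfies neither `bβ = aγ` nor `α = β + γ`, then `S_O` has NO
psd factorization of size `4` (rank-one factors by `factors_rank_le_one`, then Lemma 2.4 = FGPRT
Prop. 6.2 would give a Hadamard square root of rank `≤ 4`). [cite: GouveiaRobinsonThomas2013, Thm. 4.8 (p11–p12)] -/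
theorem not_hasPsdFactorization_four (h1 : b * octaBeta z w ≠ a * octaGamma z w)
    (h2 : octaAlpha z w ≠ octaBeta z w + octaGamma z w) :
    ¬ HasPsdFactorization (planarOctahedronSlack a b z w) 4 := by
  rintro ⟨A, B, hA, hB, hM⟩
  obtain ⟨hAr, hBr⟩ := h.factors_rank_le_one A B hA hB hM
  exact h.not_hasHadamardSqrtOfRankLE_four h1 h2
    (FawziEtAl2015_prop62_holds (Fin 6) (Fin 8) (planarOctahedronSlack a b z w) 4
      ⟨A, B, fun i => ⟨hA i, hAr i⟩, fun j => ⟨hB j, hBr j⟩, hM⟩)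

end PlanarOctahedronHyp

/-- **GRT Theorem 4.8** (p11, verbatim): "An octahedron `O ⊂ ℝ³` has psd rank four if and only if
`O` is biplanar." Typed for GRT's normal form of an octahedron planar with respect to the `xy` plane
(vertices `(0,0,0),(1,0,0),(0,1,0),(a,b,0),z,w`, printed slack matrix `S_O`, printed planarity
conditions `bβ = aγ` / `α = β + γ` for the two further candidate planes): `S_O` has a psd
factorization of size `4` iff one of the two conditions holds; `rank_psd S_O ≥ 4` and `≤ 5` always,
so `rank_psd S_O = 5` exactly when neither holds. [cite: GouveiaRobinsonThomas2013, Thm. 4.8 (p11–p12)] -/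
theorem GouveiaRobinsonThomas2013_thm48
    {a b : ℝ} {z w : Fin 3 → ℝ} (h : PlanarOctahedronHyp a b z w) :
    (HasPsdFactorization (planarOctahedronSlack a b z w) 4 ↔
        (b * octaBeta z w = a * octaGamma z w ∨ octaAlpha z w = octaBeta z w + octaGamma z w)) ∧
    (∀ k, HasPsdFactorization (planarOctahedronSlack a b z w) k → 4 ≤ k) ∧
    HasPsdFactorization (planarOctahedronSlack a b z w) 5 ∧
    (¬ (b * octaBeta z w = a * octaGamma z w ∨ octaAlpha z w = octaBeta z w + octaGamma z w) →
      ∀ k, HasPsdFactorization (planarOctahedronSlack a b z w) k → 5 ≤ k) := by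
  refine ⟨⟨fun h4 => ?_, h.hasPsdFactorization_four⟩, fun k hk => h.four_le_of_hasPsdFactorization hk,
    h.hasPsdFactorization_five, fun hnot k hk => ?_⟩
  · by_contra hnot
    exact h.not_hasPsdFactorization_four (fun h1 => hnot (Or.inl h1)) (fun h2 => hnot (Or.inr h2)) h4
  · by_contra hlt
    exact h.not_hasPsdFactorization_four (fun h1 => hnot (Or.inl h1)) (fun h2 => hnot (Or.inr h2))
      (hk.mono (by omega))

end Literature.Combinatorics.Optimization
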